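import Literature.Analysis.FunctionSpaces.TorusChainRule
import Literature.Analysis.FunctionSpaces.TorusCalculusProofs
import HarnessLib

/-!
# FunctionalMining — the viscous term has a sign for CONVEX tensor weights

Search for candidate a priori estimates; no regularity claim. Cell `pub-nsfunc`, prove seat
(gen 16). The dissipation step of every moment balance in the K0 programme (Gibbon's Laplacian
step for `∫|ω|^{2m}`, Kato's inequality for `∫(|S|²+ε)^{q/2}`, `StrainViscous`,
`VorticityMomentViscous`) is an instance of ONE convexity fact, recorded here for an arbitrary
`C²` weight of an arbitrary Euclidean-valued smooth field on the torus:

**`ConvexWeight.integral_fderiv_laplacian_nonpos`.** If `Θ : T^d → ℝ^ι` is smooth, `G` is `C²` on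
an open set `U ⊇ Θ(T^d)` and the second derivative of `G` is positive semidefinite at the values
of `Θ` (`D²G(Θ y)[w, w] ≥ 0`), then

`∫_{T^d} DG(Θ)[ΔΘ] ≤ 0`.

Proof: with `φₖ := DG(Θ)[∂ₖΘ] = ∂ₖ(G ∘ Θ)` one has `∫ ∂ₖφₖ = 0` (periodicity) and
`∂ₖφₖ = D²G(Θ)[∂ₖΘ, ∂ₖΘ] + DG(Θ)[∂ₖ∂ₖΘ]` (Leibniz rule for the evaluation pairing), so
`∫ DG(Θ)[ΔΘ] = ∑ₖ ∫ DG(Θ)[∂ₖ∂ₖΘ] = −∑ₖ ∫ D²G(Θ)[∂ₖΘ, ∂ₖΘ] ≤ 0`.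

Used with `G` = a smooth convex regularisation of `S ↦ λ₁(S)^q` (rows `ES.lam1.q|T_C|C1`).
[ours; folklore calculus — Evans 2010 App. C.2 (no boundary on the torus)]
-/

noncomputable section

open MeasureTheory Set Filter Topology Finset
open scoped ContDiff

namespace Summit.NavierStokesRegularity.FunctionalMining

open Literature.Analysis.FunctionSpaces Literature.Analysis.FunctionSpaces.Torus

namespace ConvexWeight

variable {d : Type*} [Fintype d] [DecidableEq d]
variable {E : Type*} [NormedAddCommGroup E] [NormedSpace ℝ E]

/-- Along the coordinate line through `y` in direction `eₖ`, a `C¹` map on the torus has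
derivative `∂ₖf(y)` at parameter `0`. [folklore] -/
theorem hasDerivAt_line (k : d) {f : UnitAddTorus d → E} (hf : IsContDiff 1 f) (y : UnitAddTorus d) :
    HasDerivAt (fun t : ℝ => f (y + proj (t • EuclideanSpace.single k (1 : ℝ))))
      (partialDeriv k f y) 0 := by
  simpa [Torus.partialDeriv] using
    Torus.hasDerivAt_comp_add_proj_smul hf y (EuclideanSpace.single k (1 : ℝ)) 0

/-- **Leibniz rule for the evaluation pairing along a coordinate line**: for `G` of class `C²` on an
open `U ∋ Θ(y)` (all `y`) and smooth `Θ`, the function `φₖ = DG(Θ)[∂ₖΘ]` has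
`∂ₖφₖ(y) = D²G(Θ y)[∂ₖΘ y](∂ₖΘ y) + DG(Θ y)[∂ₖ∂ₖΘ y]`. [folklore] -/
theorem partialDeriv_fderiv_apply_partialDeriv {U : Set E} (hU : IsOpen U) {G : E → ℝ}
    (hG : ContDiffOn ℝ 2 G U) {Θ : UnitAddTorus d → E} (hΘ : IsSmooth Θ) (hmaps : ∀ y, Θ y ∈ U)
    (k : d) (y : UnitAddTorus d) :
    partialDeriv k (fun z => fderiv ℝ G (Θ z) (partialDeriv k Θ z)) y =
      (fderiv ℝ (fderiv ℝ G) (Θ y) (partialDeriv k Θ y)) (partialDeriv k Θ y) +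
        fderiv ℝ G (Θ y) (partialDeriv k (partialDeriv k Θ) y) := by
  have hΘ1 : IsContDiff 1 Θ := hΘ.isContDiff (by simp)
  have hΘk1 : IsContDiff 1 (partialDeriv k Θ) := (hΘ.partialDeriv k).isContDiff (by simp)
  have hG2 : HasFDerivAt (fderiv ℝ G) (fderiv ℝ (fderiv ℝ G) (Θ y)) (Θ y) :=
    ((((hG.contDiffAt (hU.mem_nhds (hmaps y))).fderiv_right (m := 1) le_rfl).differentiableAt
      (by simp)).hasFDerivAt)
  -- the two factors along the line
  have hc : HasDerivAt (fun t : ℝ => fderiv ℝ G (Θ (y + proj (t • EuclideanSpace.single k (1 : ℝ)))))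
      (fderiv ℝ (fderiv ℝ G) (Θ y) (partialDeriv k Θ y)) 0 :=
    hG2.comp_hasDerivAt_of_eq (0 : ℝ) (hasDerivAt_line k hΘ1 y) (by simp)
  have hu : HasDerivAt (fun t : ℝ => partialDeriv k Θ (y + proj (t • EuclideanSpace.single k (1 : ℝ))))
      (partialDeriv k (partialDeriv k Θ) y) 0 := hasDerivAt_line k hΘk1 y
  have h := hc.clm_apply hu
  simp only [zero_smul, proj_zero, add_zero] at h
  rw [Torus.partialDeriv, Torus.lineDeriv, h.deriv]

/-- `φₖ = DG(Θ)[∂ₖΘ]` is of class `C¹` on the torus. [folklore] -/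
theorem isContDiff_one_fderiv_apply_partialDeriv {U : Set E} (hU : IsOpen U) {G : E → ℝ}
    (hG : ContDiffOn ℝ 2 G U) {Θ : UnitAddTorus d → E} (hΘ : IsSmooth Θ) (hmaps : ∀ y, Θ y ∈ U)
    (k : d) : IsContDiff 1 (fun z => fderiv ℝ G (Θ z) (partialDeriv k Θ z)) := by
  have hΘ1 : IsContDiff 1 Θ := hΘ.isContDiff (by simp)
  have hΘk1 : IsContDiff 1 (partialDeriv k Θ) := (hΘ.partialDeriv k).isContDiff (by simp)
  have hG1 : ContDiffOn ℝ 1 (fderiv ℝ G) U := hG.fderiv_of_isOpen hU le_rfl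
  have hcomp : ContDiff ℝ 1 (fun x => fderiv ℝ G (lift Θ x)) :=
    hG1.comp_contDiff hΘ1 fun x => hmaps _
  unfold IsContDiff
  exact hcomp.clm_apply hΘk1

/-- The second-derivative density `y ↦ D²G(Θ y)[∂ₖΘ y](∂ₖΘ y)` is continuous. [folklore] -/
theorem continuous_hessian_apply {U : Set E} (hU : IsOpen U) {G : E → ℝ}
    (hG : ContDiffOn ℝ 2 G U) {Θ : UnitAddTorus d → E} (hΘ : IsSmooth Θ) (hmaps : ∀ y, Θ y ∈ U)
    (k : d) :
    Continuous fun y => (fderiv ℝ (fderiv ℝ G) (Θ y) (partialDeriv k Θ y)) (partialDeriv k Θ y) := by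
  have hG1 : ContDiffOn ℝ 1 (fderiv ℝ G) U := hG.fderiv_of_isOpen hU le_rfl
  have hG2c : ContinuousOn (fderiv ℝ (fderiv ℝ G)) U := hG1.continuousOn_fderiv_of_isOpen hU le_rfl
  have h1 : Continuous fun y => fderiv ℝ (fderiv ℝ G) (Θ y) :=
    hG2c.comp_continuous hΘ.continuous hmaps
  have h2 : Continuous fun y => partialDeriv k Θ y := (hΘ.partialDeriv k).continuous
  exact (h1.clm_apply h2).clm_apply h2

omit [DecidableEq d] in
/-- The first-derivative density `y ↦ DG(Θ y)[W y]` is continuous for continuous `W`. [folklore] -/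
theorem continuous_fderiv_apply {U : Set E} (hU : IsOpen U) {G : E → ℝ}
    (hG : ContDiffOn ℝ 2 G U) {Θ : UnitAddTorus d → E} (hΘ : IsSmooth Θ) (hmaps : ∀ y, Θ y ∈ U)
    {W : UnitAddTorus d → E} (hW : Continuous W) :
    Continuous fun y => fderiv ℝ G (Θ y) (W y) := by
  have hG1c : ContinuousOn (fderiv ℝ G) U := hG.continuousOn_fderiv_of_isOpen hU (by norm_num)
  exact (hG1c.comp_continuous hΘ.continuous hmaps).clm_apply hW

/-- **One direction**: `∫ DG(Θ)[∂ₖ∂ₖΘ] = −∫ D²G(Θ)[∂ₖΘ, ∂ₖΘ]`. [folklore] -/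
theorem integral_fderiv_partialDeriv_partialDeriv_eq {U : Set E} (hU : IsOpen U) {G : E → ℝ}
    (hG : ContDiffOn ℝ 2 G U) {Θ : UnitAddTorus d → E} (hΘ : IsSmooth Θ) (hmaps : ∀ y, Θ y ∈ U)
    (k : d) :
    ∫ y, fderiv ℝ G (Θ y) (partialDeriv k (partialDeriv k Θ) y) =
      -∫ y, (fderiv ℝ (fderiv ℝ G) (Θ y) (partialDeriv k Θ y)) (partialDeriv k Θ y) := by
  have hzero := Torus.integral_partialDeriv_eq_zero_of_isContDiff
    (isContDiff_one_fderiv_apply_partialDeriv hU hG hΘ hmaps k) k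
  simp_rw [partialDeriv_fderiv_apply_partialDeriv hU hG hΘ hmaps k] at hzero
  have hi1 := (continuous_hessian_apply hU hG hΘ hmaps k).integrable_unitAddTorus
  have hi2 := (continuous_fderiv_apply hU hG hΘ hmaps
    ((hΘ.partialDeriv k).partialDeriv k).continuous).integrable_unitAddTorus
  rw [integral_add hi1 hi2] at hzero
  linarith

/-- **The viscous term has a sign for convex weights**: if `D²G(Θ y)[w, w] ≥ 0` for all `y`, `w`
(e.g. `G` convex and `C²` near the range of `Θ`), then `∫ DG(Θ)[ΔΘ] ≤ 0`. [ours; folklore] -/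
theorem integral_fderiv_laplacian_nonpos {U : Set E} (hU : IsOpen U) {G : E → ℝ}
    (hG : ContDiffOn ℝ 2 G U) {Θ : UnitAddTorus d → E} (hΘ : IsSmooth Θ) (hmaps : ∀ y, Θ y ∈ U)
    (hpsd : ∀ y (w : E), 0 ≤ (fderiv ℝ (fderiv ℝ G) (Θ y) w) w) :
    ∫ y, fderiv ℝ G (Θ y) (Torus.laplacian Θ y) ≤ 0 := by
  have hlap : ∀ y, fderiv ℝ G (Θ y) (Torus.laplacian Θ y) =
      ∑ k, fderiv ℝ G (Θ y) (partialDeriv k (partialDeriv k Θ) y) := fun y => by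
    rw [Torus.laplacian_eq_sum_partialDeriv_partialDeriv hΘ y, map_sum]
  simp_rw [hlap]
  rw [integral_finsetSum _ fun k _ => (continuous_fderiv_apply hU hG hΘ hmaps
    ((hΘ.partialDeriv k).partialDeriv k).continuous).integrable_unitAddTorus]
  refine Finset.sum_nonpos fun k _ => ?_
  rw [integral_fderiv_partialDeriv_partialDeriv_eq hU hG hΘ hmaps k, neg_nonpos]
  exact integral_nonneg fun y => hpsd y _

end ConvexWeight

end Summit.NavierStokesRegularity.FunctionalMining

end
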